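import Summits.ResolutionOfSingularities.ResolutionOfSingularities.Theorems.FrobeniusClosingSteerWords20DerivationCurrency
import Summits.ResolutionOfSingularities.ResolutionOfSingularities.Theorems.FrobeniusClosingSteerCleanedOrderMonotone
import Summits.ResolutionOfSingularities.ResolutionOfSingularities.Theorems.FrobeniusClosingSteerCleaningOptimalOfIsolated

/-!
# Crux `Steer` (stmt-ResolutionOfSingularities-16345), line `switching-dichotomy` — WORDS 21: §σ2.26 v2 PART 2 — the PROVED reductions `noEternalStrippedRadicandChainH_of_constOrder` / `…HP_of_constOrder`, Q2 `sub_pow_mem_pow_of_law`, the in-file leaves `derivationStepTransfer_holds` (res-type-096 p524779) / `cleaningExact_holds` (res-D-pv-011 p524687), `…H_three_of_pieces` / `…HP_four_of_pieces` (HOIST of the registered skeleton r49 bb092f8f650aca19, l.1449–1697, inside `section HeightSplitTwo` with its `variable {K : Type} [Field K]`)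

Holder res-L0-w41-lead-1 g6 on res-L0-w41-plan-1 RULING 47 (E1) / 104b; see `…Words01Core` for the hoist protocol (bodies byte for byte;
`[cite: …]` / `[folklore]` tags on CLOSED `def … : Prop` words are written «(ref. …)» / «(folklore)» — GATE NOTE of `…Words02Stubs`;
cite keys inside `[cite:]` tags normalised to `references.bib` keys where needed, as in `…Words03Phases`).
Nothing here is a statement of the manuscript [claim: Hironaka2017, status: under-review]. OURS (candidates / vocabulary; AI review is
weaker than expert review).
-/

open Summit.ResolutionOfSingularities.ResolutionOfSingularities.Theses.FrobeniusClosing (IsolatedForcedTermination)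
open Literature.AlgebraicGeometry.Resolution (IsAbhyankarPlace FGOver exists_ringKrullDim_eq_and_trdeg_eq
  trdeg_eq_trdeg_of_isFractionRing locAtCentre IsQuadraticTransformAlong SubringDominates IsRsopPart
  LocalUniformization3 RelLocalUniformization CossartPiltant2019General)
open Summit.ResolutionOfSingularities.ResolutionOfSingularities.Theorems.SteerRankThinness
  (HasProperCoarsening concl_of_hasProperCoarsening rankOne_of_not_hasProperCoarsening)
open Summit.ResolutionOfSingularities.ResolutionOfSingularities.Theorems.PfaffLine

set_option linter.dupNamespace false

namespace Summit.ResolutionOfSingularities.ResolutionOfSingularities.Theorems.SwitchingDichotomy.Words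

section SteeredTwo

open IsLocalRing
open Literature.AlgebraicGeometry.Resolution (IsLocalBlowupAlong IsQuadraticTransform IsExcellentRing)

variable {K : Type} [Field K]


/-- **§σ2.26 v2 REDUCTION** (PROVED; plan-1 RULING 84b): K♭ v2.2 (c) ⟸ (B2) `DerivationStepTransfer` ∧ (C) `CleaningExact` ∧ G(c, p·e) for all `e ≥ 2`, in codimension `c ≥ 3`, `p` prime. (C) makes every full strip exact; H turns the optimal cleaner into a derivation `D` with `D (f m)` of exact order `ν ∈ {p e m − 1, p e m}` in the shape (B2) consumes; (B2) transports it to `D₁ (f (m+1)) ∉ 𝔪^(ν+1)`; (C) at the next stage and the order-drop lemma give `p e (m+1) − 1 ≤ ν`, so `e (m+1) ≤ e m`; an antitone `ℕ`-sequence is eventually constant `= e∞`, `hinf` gives `e∞ ≥ 2`, and the tail is a G(c, p e∞)-chain. OURS. [folklore] -/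
theorem noEternalStrippedRadicandChainH_of_constOrder {p c : ℕ} (hp : p.Prime) (hc : 2 < c)
    (hB2 : DerivationStepTransfer p c) (hCE : CleaningExact p c)
    (hG : ∀ e : ℕ, 2 ≤ e → NoEternalConstOrderIsolatedChain p c (p * e)) :
    NoEternalStrippedRadicandChainH p c := by
  intro L _ _ S _ hle f g x e he hinf hreg hexc hdim hqt hspan hlaw hmult hH hiso
  have hp2 : 2 ≤ p := hp.two_le
  -- (C) at every stage: the full strip is exact
  have hC : ∀ m, f m - g m ^ p ∈ maximalIdeal (S m) ^ (p * e m) ∧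
      ∀ h : S m, f m - h ^ p ∉ maximalIdeal (S m) ^ (p * e m + 1) := fun m =>
    hCE hc L (S m) (S (m + 1)) (hle m) (f m) (g m) (f (m + 1)) (x m) (e m) hp (he m) (hreg m) (hreg (m + 1))
      (hexc m) (hexc (m + 1)) (hdim m) (hdim (m + 1)) (hqt m) (hspan m) (hlaw m) (hmult (m + 1)) (hiso (m + 1))
  have hDsub : ∀ m (D : Derivation ℤ (S m) (S m)), D (f m - g m ^ p) = D (f m) := fun m D => by
    rw [map_sub, derivation_subring_apply_pow_eq_zero p (S m) D (g m), sub_zero]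
  have h1le : ∀ m, 1 ≤ p * e m := fun m => le_trans (by omega) (Nat.mul_le_mul hp2 (he m))
  -- (B2): the exponent never increases
  have hstep : ∀ m, e (m + 1) ≤ e m := by
    intro m
    obtain ⟨hmem, hopt⟩ := hC m
    obtain ⟨D, hD⟩ := hH m (p * e m) hopt hmem
    have hDf : D (f m) ∈ maximalIdeal (S m) ^ (p * e m - 1) := by
      rw [← hDsub m D]
      refine derivation_apply_mem_pow_of_mem_pow_succ D _ (p * e m - 1) ?_
      rw [Nat.sub_add_cancel (h1le m)]
      exact hmem
    have hν : ∃ ν : ℕ, D (f m) ∈ maximalIdeal (S m) ^ ν ∧ D (f m) ∉ maximalIdeal (S m) ^ (ν + 1) ∧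
        (p * e m = ν + 1 ∨ (p * e m = ν ∧ ∀ y ∈ maximalIdeal (S m), D y ∈ maximalIdeal (S m))) := by
      rcases hD with hD | ⟨hlog, hD⟩
      · refine ⟨p * e m - 1, hDf, ?_, Or.inl (Nat.sub_add_cancel (h1le m)).symm⟩
        rw [Nat.sub_add_cancel (h1le m)]
        exact hD
      · by_cases hmid : D (f m) ∈ maximalIdeal (S m) ^ (p * e m)
        · exact ⟨p * e m, hmid, hD, Or.inr ⟨rfl, hlog⟩⟩
        · refine ⟨p * e m - 1, hDf, ?_, Or.inl (Nat.sub_add_cancel (h1le m)).symm⟩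
          rw [Nat.sub_add_cancel (h1le m)]
          exact hmid
    obtain ⟨ν, hν1, hν2, hν3⟩ := hν
    have hνle : ν ≤ p * e m := by
      rcases hν3 with h | ⟨h, _⟩ <;> omega
    obtain ⟨D₁, hD₁⟩ := hB2 L (S m) (S (m + 1)) (hle m) (f m) (g m) (f (m + 1)) (x m) (e m) hp (he m) (hreg m)
      (hreg (m + 1)) (hdim m) (hdim (m + 1)) (hqt m) (hspan m) (hlaw m) ν ⟨D, hν1, hν2, hν3⟩
    obtain ⟨hmem1, -⟩ := hC (m + 1)
    have hD₁f : D₁ (f (m + 1)) ∈ maximalIdeal (S (m + 1)) ^ (p * e (m + 1) - 1) := by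
      rw [← hDsub (m + 1) D₁]
      refine derivation_apply_mem_pow_of_mem_pow_succ D₁ _ (p * e (m + 1) - 1) ?_
      rw [Nat.sub_add_cancel (h1le (m + 1))]
      exact hmem1
    refine not_lt.mp fun hlt => hD₁ (Ideal.pow_le_pow_right ?_ hD₁f)
    have hmul : p * (e m + 1) ≤ p * e (m + 1) := Nat.mul_le_mul_left p (Nat.succ_le_of_lt hlt)
    rw [mul_add_one] at hmul
    have h1 := h1le (m + 1)
    generalize p * e m = a at hνle hmul
    generalize p * e (m + 1) = b at hmul h1
    omega
  have hanti : ∀ m n : ℕ, e (m + n) ≤ e m := by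
    intro m n
    induction n with
    | zero => exact le_rfl
    | succ n ih => exact (hstep (m + n)).trans ih
  classical
  have hP : ∃ v : ℕ, ∃ m, e m = v := ⟨e 0, 0, rfl⟩
  obtain ⟨m₀, hm₀⟩ := Nat.find_spec hP
  have hmin : ∀ m, Nat.find hP ≤ e m := fun m => Nat.find_min' hP ⟨m, rfl⟩
  have hconst : ∀ n, e (m₀ + n) = Nat.find hP := fun n => le_antisymm ((hanti m₀ n).trans hm₀.le) (hmin _)
  obtain ⟨m, hm, h2⟩ := hinf m₀
  have hv2 : 2 ≤ Nat.find hP := by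
    obtain ⟨n, rfl⟩ := Nat.exists_eq_add_of_le hm
    exact h2.trans (hconst n).le
  haveI : ∀ n, IsLocalRing ((fun n => S (m₀ + n)) n) := fun n => inferInstance
  refine hG (Nat.find hP) hv2 L (fun n => S (m₀ + n)) (fun n => hle (m₀ + n)) (fun n => f (m₀ + n)) (fun n => g (m₀ + n))
    (fun n => x (m₀ + n)) (fun n => hreg (m₀ + n)) (fun n => hexc (m₀ + n)) (fun n => hdim (m₀ + n))
    (fun n => hqt (m₀ + n)) (fun n => hspan (m₀ + n)) (fun n => ?_) (fun n => hmult (m₀ + n))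
    (fun n h => ?_) (fun n => hH (m₀ + n)) (fun n => hiso (m₀ + n))
  · have hl := hlaw (m₀ + n)
    rw [hconst n] at hl
    exact hl
  · have ho := (hC (m₀ + n)).2 h
    rw [hconst n] at ho
    exact ho

/-- **§σ2.26 v2 REDUCTION, perfect-residue regime** (PROVED; same proof with the perfectness binder threaded): K♭ v2.2-perfect (c) ⟸ (B2) ∧ (C) ∧ G-perf(c, p·e) for all `e ≥ 2`. This is the shape F-B♮ consumes at `c = 4` (RULING 86b/d). OURS. [folklore] -/
theorem noEternalStrippedRadicandChainHP_of_constOrder {p c : ℕ} (hp : p.Prime) (hc : 2 < c)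
    (hB2 : DerivationStepTransfer p c) (hCE : CleaningExact p c)
    (hG : ∀ e : ℕ, 2 ≤ e → NoEternalConstOrderIsolatedChainPerfect p c (p * e)) :
    NoEternalStrippedRadicandChainHP p c := by
  intro L _ _ S _ hle f g x e he hinf hreg hexc hdim hqt hspan hlaw hmult hH hperf hiso
  have hp2 : 2 ≤ p := hp.two_le
  -- (C) at every stage: the full strip is exact
  have hC : ∀ m, f m - g m ^ p ∈ maximalIdeal (S m) ^ (p * e m) ∧
      ∀ h : S m, f m - h ^ p ∉ maximalIdeal (S m) ^ (p * e m + 1) := fun m =>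
    hCE hc L (S m) (S (m + 1)) (hle m) (f m) (g m) (f (m + 1)) (x m) (e m) hp (he m) (hreg m) (hreg (m + 1))
      (hexc m) (hexc (m + 1)) (hdim m) (hdim (m + 1)) (hqt m) (hspan m) (hlaw m) (hmult (m + 1)) (hiso (m + 1))
  have hDsub : ∀ m (D : Derivation ℤ (S m) (S m)), D (f m - g m ^ p) = D (f m) := fun m D => by
    rw [map_sub, derivation_subring_apply_pow_eq_zero p (S m) D (g m), sub_zero]
  have h1le : ∀ m, 1 ≤ p * e m := fun m => le_trans (by omega) (Nat.mul_le_mul hp2 (he m))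
  -- (B2): the exponent never increases
  have hstep : ∀ m, e (m + 1) ≤ e m := by
    intro m
    obtain ⟨hmem, hopt⟩ := hC m
    obtain ⟨D, hD⟩ := hH m (p * e m) hopt hmem
    have hDf : D (f m) ∈ maximalIdeal (S m) ^ (p * e m - 1) := by
      rw [← hDsub m D]
      refine derivation_apply_mem_pow_of_mem_pow_succ D _ (p * e m - 1) ?_
      rw [Nat.sub_add_cancel (h1le m)]
      exact hmem
    have hν : ∃ ν : ℕ, D (f m) ∈ maximalIdeal (S m) ^ ν ∧ D (f m) ∉ maximalIdeal (S m) ^ (ν + 1) ∧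
        (p * e m = ν + 1 ∨ (p * e m = ν ∧ ∀ y ∈ maximalIdeal (S m), D y ∈ maximalIdeal (S m))) := by
      rcases hD with hD | ⟨hlog, hD⟩
      · refine ⟨p * e m - 1, hDf, ?_, Or.inl (Nat.sub_add_cancel (h1le m)).symm⟩
        rw [Nat.sub_add_cancel (h1le m)]
        exact hD
      · by_cases hmid : D (f m) ∈ maximalIdeal (S m) ^ (p * e m)
        · exact ⟨p * e m, hmid, hD, Or.inr ⟨rfl, hlog⟩⟩
        · refine ⟨p * e m - 1, hDf, ?_, Or.inl (Nat.sub_add_cancel (h1le m)).symm⟩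
          rw [Nat.sub_add_cancel (h1le m)]
          exact hmid
    obtain ⟨ν, hν1, hν2, hν3⟩ := hν
    have hνle : ν ≤ p * e m := by
      rcases hν3 with h | ⟨h, _⟩ <;> omega
    obtain ⟨D₁, hD₁⟩ := hB2 L (S m) (S (m + 1)) (hle m) (f m) (g m) (f (m + 1)) (x m) (e m) hp (he m) (hreg m)
      (hreg (m + 1)) (hdim m) (hdim (m + 1)) (hqt m) (hspan m) (hlaw m) ν ⟨D, hν1, hν2, hν3⟩
    obtain ⟨hmem1, -⟩ := hC (m + 1)
    have hD₁f : D₁ (f (m + 1)) ∈ maximalIdeal (S (m + 1)) ^ (p * e (m + 1) - 1) := by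
      rw [← hDsub (m + 1) D₁]
      refine derivation_apply_mem_pow_of_mem_pow_succ D₁ _ (p * e (m + 1) - 1) ?_
      rw [Nat.sub_add_cancel (h1le (m + 1))]
      exact hmem1
    refine not_lt.mp fun hlt => hD₁ (Ideal.pow_le_pow_right ?_ hD₁f)
    have hmul : p * (e m + 1) ≤ p * e (m + 1) := Nat.mul_le_mul_left p (Nat.succ_le_of_lt hlt)
    rw [mul_add_one] at hmul
    have h1 := h1le (m + 1)
    generalize p * e m = a at hνle hmul
    generalize p * e (m + 1) = b at hmul h1
    omega
  have hanti : ∀ m n : ℕ, e (m + n) ≤ e m := by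
    intro m n
    induction n with
    | zero => exact le_rfl
    | succ n ih => exact (hstep (m + n)).trans ih
  classical
  have hP : ∃ v : ℕ, ∃ m, e m = v := ⟨e 0, 0, rfl⟩
  obtain ⟨m₀, hm₀⟩ := Nat.find_spec hP
  have hmin : ∀ m, Nat.find hP ≤ e m := fun m => Nat.find_min' hP ⟨m, rfl⟩
  have hconst : ∀ n, e (m₀ + n) = Nat.find hP := fun n => le_antisymm ((hanti m₀ n).trans hm₀.le) (hmin _)
  obtain ⟨m, hm, h2⟩ := hinf m₀
  have hv2 : 2 ≤ Nat.find hP := by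
    obtain ⟨n, rfl⟩ := Nat.exists_eq_add_of_le hm
    exact h2.trans (hconst n).le
  haveI : ∀ n, IsLocalRing ((fun n => S (m₀ + n)) n) := fun n => inferInstance
  refine hG (Nat.find hP) hv2 L (fun n => S (m₀ + n)) (fun n => hle (m₀ + n)) (fun n => f (m₀ + n)) (fun n => g (m₀ + n))
    (fun n => x (m₀ + n)) (fun n => hreg (m₀ + n)) (fun n => hexc (m₀ + n)) (fun n => hdim (m₀ + n))
    (fun n => hqt (m₀ + n)) (fun n => hspan (m₀ + n)) (fun n => ?_) (fun n => hmult (m₀ + n))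
    (fun n h => ?_) (fun n => hH (m₀ + n)) (fun n => hperf (m₀ + n)) (fun n => hiso (m₀ + n))
  · have hl := hlaw (m₀ + n)
    rw [hconst n] at hl
    exact hl
  · have ho := (hC (m₀ + n)).2 h
    rw [hconst n] at ho
    exact ho

/-- **Q2 in the K♭ step currency** (PROVED): along a quadratic transform `S₀ ≤ S₁` of a REGULAR local subring with `𝔪₀·S₁ = (x₀)`, a law
`f₁ · x₀^N = f₀ − g₀^p` with `f₁ ∈ S₁` forces `f₀ − g₀^p ∈ 𝔪₀^N` (`x₀^N S₁ ∩ S₀ ⊆ 𝔪₀^N`: Chevalley valuation ring dominating `S₁`, the transform is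
the local blowing up along it at a least-value `x ∈ 𝔪₀`, `x₀ = b·x` in `S₁`, then `QuadraticStep.mul_pow_mem_maximalIdeal_pow`). OURS.
[cite: ZariskiSamuel1960, Ch. VIII §1 Thm. 1] [cite: Cutkosky2014, §2.1] [folklore] -/
theorem sub_pow_mem_pow_of_law {L : Type} [Field L] (p : ℕ) {S₀ S₁ : Subring L} [IsLocalRing S₀] [IsLocalRing S₁]
    (hreg₀ : IsRegularLocalRing S₀) (hQT : IsQuadraticTransform S₀ S₁) (h₀₁ : S₀ ≤ S₁)
    (f₀ g₀ : S₀) (f₁ x₀ : S₁) (N : ℕ)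
    (hspan : Ideal.span ((fun y : S₀ => (⟨(y : L), h₀₁ y.2⟩ : S₁)) '' (maximalIdeal S₀ : Set S₀)) = Ideal.span {x₀})
    (hlaw : ((f₁ : S₁) : L) * ((x₀ : S₁) : L) ^ N = ((f₀ : S₀) : L) - ((g₀ : S₀) : L) ^ p) :
    f₀ - g₀ ^ p ∈ maximalIdeal S₀ ^ N := by
  classical
  haveI := hreg₀
  obtain ⟨W, hW⟩ := (LocalSubring.mk S₁).exists_le_valuationSubring
  haveI : IsLocalRing W.toSubring := inferInstanceAs (IsLocalRing W)
  have hSW : SubringDominates S₁ W.toSubring := (Literature.AlgebraicGeometry.Resolution.subringDominates_iff S₁ W.toSubring).mpr hW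
  have hdom : SubringDominates S₀ S₁ := hQT.dominates
  have hdom₀ : SubringDominates S₀ W.toSubring := hdom.trans hSW
  have hA : IsQuadraticTransformAlong W S₀ S₁ := hQT.along ⟨inferInstance, IsNoetherian.noetherian _⟩ hSW
  obtain ⟨_, x, hxm, hx0, _, hS₁⟩ := hA.exists_eq_locAtCentre
  have hx0K : (x : L) ≠ 0 := fun h => hx0 (Subtype.ext h)
  have hvx : W.valuation (x : L) < 1 := ((Literature.AlgebraicGeometry.Resolution.subringDominates_valuationSubring_iff hdom₀.1).mp hdom₀ x).mp hxm
  have hxS₁ : (x : L) ∈ S₁ := h₀₁ x.2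
  have hBS : Literature.AlgebraicGeometry.Resolution.blowupRing S₀ (x : L) ≤ S₁ := by
    rw [hS₁]
    exact Literature.AlgebraicGeometry.Resolution.le_locAtCentre _ W
  -- `x₀ = b · x` in `S₁`
  have hx₀X : x₀ ∈ Ideal.span {(⟨(x : L), hxS₁⟩ : S₁)} := by
    have hle : Ideal.span ((fun y : S₀ => (⟨(y : L), h₀₁ y.2⟩ : S₁)) '' (maximalIdeal S₀ : Set S₀)) ≤
        Ideal.span {(⟨(x : L), hxS₁⟩ : S₁)} := by
      rw [Ideal.span_le]
      rintro _ ⟨y, hy, rfl⟩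
      refine Ideal.mem_span_singleton'.mpr ⟨⟨(y : L) / x, hBS (Literature.AlgebraicGeometry.Resolution.div_mem_blowupRing (x : L) hy)⟩, ?_⟩
      exact Subtype.ext (by
        change (y : L) / x * x = y
        rw [div_mul_cancel₀ _ hx0K])
    rw [hspan] at hle
    exact hle (Ideal.mem_span_singleton_self x₀)
  obtain ⟨b, hb⟩ := Ideal.mem_span_singleton'.mp hx₀X
  have hbL : ((x₀ : S₁) : L) = ((b : S₁) : L) * (x : L) := by
    have h := congrArg Subtype.val hb
    simpa [Subring.coe_mul] using h.symm
  -- the law rewritten: `x ^ N * (f₁ b^N) = f₀ − g₀^p`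
  have hF : (x : L) ^ N * (((f₁ * b ^ N : S₁)) : L) = (((f₀ - g₀ ^ p : S₀)) : L) := by
    have h1 : (((f₀ - g₀ ^ p : S₀)) : L) = ((f₀ : S₀) : L) - ((g₀ : S₀) : L) ^ p := by push_cast; ring
    rw [h1, ← hlaw, hbL]
    push_cast
    ring
  have hxa : (x : L) ^ N * (((f₁ * b ^ N : S₁)) : L) ∈ S₀ := by
    rw [hF]
    exact (f₀ - g₀ ^ p).2
  have hQ2 := _root_.Summit.ResolutionOfSingularities.ResolutionOfSingularities.Theorems.SwitchingDichotomy.QuadraticStep.mul_pow_mem_maximalIdeal_pow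
    hA hdom₀ x.2 hvx (f₁ * b ^ N).2 N hxa
  have heq : (⟨(x : L) ^ N * (((f₁ * b ^ N : S₁)) : L), hxa⟩ : S₀) = f₀ - g₀ ^ p := Subtype.ext hF
  rw [heq] at hQ2
  exact hQ2

/-- **(B2) DISCHARGED** — `DerivationStepTransfer p c` for every `p c`, by res-type-096's step theorem
`CleanedOrderMonotone.exists_derivation_apply_not_mem_pow_succ_of_law` (p524779 ✓; regular + QT + span + law only). OURS. [folklore] -/
theorem derivationStepTransfer_holds (p c : ℕ) : DerivationStepTransfer p c := by
  intro L _ _ S₀ S₁ _ _ h₀₁ f₀ g₀ f₁ x₀ e₀ _ _ hreg₀ _ _ _ hqt hspan hlaw ν hD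
  obtain ⟨D, hν, hν', hcase⟩ := hD
  haveI := hreg₀
  exact _root_.Summit.ResolutionOfSingularities.ResolutionOfSingularities.Theorems.SwitchingDichotomy.CleanedOrderMonotone.exists_derivation_apply_not_mem_pow_succ_of_law
    p hqt h₀₁ f₀ g₀ f₁ x₀ e₀ hspan hlaw D ν hν hν' hcase

/-- **(C) DISCHARGED** — `CleaningExact p c` for every `p c`: the membership half by Q2 (`sub_pow_mem_pow_of_law`), the optimality half by
res-D-pv-011's `CleaningOptimal.cleaning_optimal_of_quadraticTransform` (p524687 ✓; uses `2 < c` once). OURS. [folklore] -/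
theorem cleaningExact_holds (p c : ℕ) : CleaningExact p c := by
  intro hc L _ _ S₀ S₁ _ _ h₀₁ f₀ g₀ f₁ x₀ e₀ hp _ hreg₀ hreg₁ _ _ _ hd₁ hqt hspan hlaw hmult₁ hiso₁
  haveI : Fact p.Prime := ⟨hp⟩
  refine ⟨sub_pow_mem_pow_of_law p hreg₀ hqt h₀₁ f₀ g₀ f₁ x₀ (p * e₀) hspan hlaw, ?_⟩
  exact _root_.Summit.ResolutionOfSingularities.ResolutionOfSingularities.Theorems.SwitchingDichotomy.CleaningOptimal.cleaning_optimal_of_quadraticTransform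
    p S₀ S₁ h₀₁ f₀ g₀ f₁ x₀ e₀ hc hreg₀ hreg₁ hd₁ hqt hspan hlaw hmult₁ (fun P _ hP => hiso₁ P hP)

/-- **hS3 in the v2.2 currency** (the shape slate7 consumes): K♭ v2.2 (3) ⟸ G-perf(3, p·e) (RUNG, idea-3) ∧ W(3, p·e) (FRONTIER, wild core),
all `e ≥ 2` ((B2), (C) discharged); at `p = 2` the exponents `p·e` are «every EVEN `d ≥ 4`». Pure logic over the reduction. OURS. [folklore] -/
theorem noEternalStrippedRadicandChainH_three_of_pieces
    (hG3 : ∀ p : ℕ, p.Prime → ∀ e : ℕ, 2 ≤ e → NoEternalConstOrderIsolatedChainPerfect p 3 (p * e))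
    (hW3 : ∀ p : ℕ, p.Prime → ∀ e : ℕ, 2 ≤ e → NoEternalConstOrderIsolatedChainImperfect p 3 (p * e)) :
    ∀ p : ℕ, p.Prime → NoEternalStrippedRadicandChainH p 3 := fun p hp =>
  noEternalStrippedRadicandChainH_of_constOrder hp (by norm_num) (derivationStepTransfer_holds p 3) (cleaningExact_holds p 3)
    fun e he => noEternalConstOrderIsolatedChain_of_perfect_of_imperfect (hG3 p hp e he) (hW3 p hp e he)

/-- **K♭ v2.2-perfect (4) ⟸ G-TAME(4)** (= G-perf(4, p·e), `e ≥ 2`; the F-B♮ side, RULING 86b/d; (B2), (C) discharged). Pure logic over the reduction.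
OURS. [folklore] -/
theorem noEternalStrippedRadicandChainHP_four_of_pieces
    (hG4 : ∀ p : ℕ, p.Prime → ∀ e : ℕ, 2 ≤ e → NoEternalConstOrderIsolatedChainPerfect p 4 (p * e)) :
    ∀ p : ℕ, p.Prime → NoEternalStrippedRadicandChainHP p 4 := fun p hp =>
  noEternalStrippedRadicandChainHP_of_constOrder hp (by norm_num) (derivationStepTransfer_holds p 4) (cleaningExact_holds p 4) (hG4 p hp)

end SteeredTwo

end Summit.ResolutionOfSingularities.ResolutionOfSingularities.Theorems.SwitchingDichotomy.Words
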